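import Literature.Analysis.FluidPDE.HardSpherePhaseSpaceProofs
import Literature.MathematicalPhysics.KineticTheory.HardSphereCampbellAEMeasurable
import Literature.MathematicalPhysics.KineticTheory.HardSphereEulerProofs
import Literature.MathematicalPhysics.KineticTheory.MetropolisOddStatistic
import Summits.AtomisticToContinuum.HydrodynamicLimit.Theorems.JParityClosureOddContactSymmetryTimeFreezing
import Summits.AtomisticToContinuum.HydrodynamicLimit.Theorems.JParityClosureOddContactSymmetryCampbellGibbs
import Summits.AtomisticToContinuum.HydrodynamicLimit.Theorems.JParityClosureOddContactSymmetryCampbellGibbsBounded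
import Summits.AtomisticToContinuum.HydrodynamicLimit.Theorems.JParityClosureOddContactSymmetryMetroMarkRegular
import Summits.AtomisticToContinuum.HydrodynamicLimit.Theorems.JParityClosureOddContactSymmetryCollisionPairSumMeasurable
import HarnessLib

/-!
# Tools for the static slab centring S1a (line `KineticSlabSketch`, piece G2 `stub_slabCentring_of`)

Crux `JParityClosure.OddContactSymmetry` (stmt-AtomisticToContinuum-17722, rev 5), line `KineticSlabSketch`, lead
`prover-line-stmt-AtomisticToContinuum-17722-c2-0` (cycle 3).  The fixed-`N` core of the assembly G2 of the registered stub
`stub_slabCentring_of` (file `…SlabCentringOf.lean`): under the flow-invariant homogeneous Gibbs law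
`G_N = localGibbsLaw σ 1 0 θ N Φ`, for a slab `(0, ℓ]`, a time-dependent weight `χ₁` and a FROZEN weight `χ₀` with
`|χ₁(t, ·) − χ₀| ≤ e` on the slab, bounded continuous `g, Ψ`:

* `slab_count_facts` — the number of ordered contact terms `#` has `E_G # = ℓ · flux(ρ_G) ≤ 2·12 v₁ ε²(N+1)N·2E‖v‖·ℓ`
  (Campbell `lintegral_collisionPairSum_localGibbsLaw_const` + counting `lintegral_collisionPairSum_le_of_le`);
* `integrable_metroOddSum` — slab sums of bounded marks are `G_N`-integrable (measurability stubs S3/S3b + `|X| ≤ C #`);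
* `slab_frozen_facts` — the frozen slab sum has mean `ℓ (flux(ρ_G m₀⁺) − flux(ρ_G m₀⁻))` (signed Campbell
  `integral_collisionPairSum_localGibbsLaw_const`), both products finite;
* `slab_mean_core` — given the flux-parity comparison (shape of G1 `stub_fluxOddBound`) and the defect bound (shape of P4
  `stub_maxwellDefectFlux`) AS HYPOTHESES, `|E_G X₁| ≤ (½(C_gC_Ψ e + 2C_χC_gC_Ψ y′) + e C_gC_Ψ) · 2·12 v₁ ε²(N+1)N·2E‖v‖·ℓ`
  (time-freezing `abs_metroOddSum_sub_le`).
-/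

noncomputable section

open scoped BigOperators Classical InnerProductSpace ENNReal Topology
open Set MeasureTheory Filter
open Literature.Analysis.FluidPDE Literature.MathematicalPhysics.KineticTheory

namespace Summit.AtomisticToContinuum.HydrodynamicLimit.Theorems.OddContactSymmetryKineticSlab

/-! ## Elementary identities of the Metropolis-odd slab sum -/

/-- The slab sum of the zero weight vanishes. [folklore] -/
theorem metroOddSum_zero_weight {σ : ℝ} {N : ℕ}
    (Φ : HardSphereFlow (Torus.geometry (Fin 3)) (hsDiameter σ N) (N + 1)) (S : Set ℝ)
    (g : ℝ → ℝ) (Ψ : V3 × V3 × V3 → ℝ) (r ϑ : ℝ) (z : Config (N + 1) (Fin 3) T3) :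
    metroOddSum σ N Φ S (fun _ => 0) g Ψ r ϑ z = 0 := by
  unfold metroOddSum
  have h0 : ∀ (s : ℝ) (w : Config (N + 1) (Fin 3) T3) (i j : Fin (N + 1)),
      metroOddMark σ N (fun _ => 0) g Ψ r ϑ s w i j = 0 := by
    intro s w i j
    dsimp only [metroOddMark]
    rw [zero_mul, zero_mul]
  simp only [h0, ite_self, Finset.sum_const_zero, finsum_zero]

/-- **Pathwise sup bound of the slab sum** (good set): if `|χ(t, ·)| ≤ C` for `t ∈ (0, ℓ]`, `|g| ≤ C_g`, `|Ψ| ≤ C_Ψ`, then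
`|metroOddSum (Ioc 0 ℓ)| ≤ C C_g C_Ψ ×` the number of ordered contact terms. [folklore] -/
theorem abs_metroOddSum_le {σ : ℝ} {N : ℕ}
    (Φ : HardSphereFlow (Torus.geometry (Fin 3)) (hsDiameter σ N) (N + 1))
    {χ : ℝ × UnitAddTorus (Fin 3) → ℝ} {g : ℝ → ℝ} {Ψ : V3 × V3 × V3 → ℝ} {r ϑ ℓ C Cg CΨ : ℝ}
    (hχ : ∀ t ∈ Ioc (0 : ℝ) ℓ, ∀ x, |χ (t, x)| ≤ C) (hg : ∀ a, |g a| ≤ Cg) (hΨ : ∀ q, |Ψ q| ≤ CΨ)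
    {z : Config (N + 1) (Fin 3) T3} (hz : z ∈ Φ.good) :
    |metroOddSum σ N Φ (Ioc 0 ℓ) χ g Ψ r ϑ z| ≤
      C * Cg * CΨ * Φ.collisionPairSum (Ioc 0 ℓ) (fun _ _ _ _ => (1 : ℝ)) z := by
  have h := abs_metroOddSum_sub_le Φ (χ₁ := χ) (χ₂ := fun _ => 0) (r := r) (ϑ := ϑ)
    (fun t ht x => by simpa using hχ t ht x) hg hΨ hz
  rwa [metroOddSum_zero_weight, sub_zero] at h

/-- A frozen weight `χ₀` (read as `(t, x) ↦ χ₀ x`) gives a time-independent mark (definitional). [folklore] -/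
theorem metroOddMark_frozen {σ : ℝ} {N : ℕ} (χ₀ : UnitAddTorus (Fin 3) → ℝ) (g : ℝ → ℝ)
    (Ψ : V3 × V3 × V3 → ℝ) (r ϑ : ℝ) :
    (fun (t : ℝ) (z : Config (N + 1) (Fin 3) T3) (i j : Fin (N + 1)) =>
        metroOddMark σ N (fun p => χ₀ p.2) g Ψ r ϑ t z i j) =
      fun _ z i j => metroOddMark σ N (fun p => χ₀ p.2) g Ψ r ϑ 0 z i j :=
  rfl

/-- On the good set the real count of ordered contact terms is the `toReal` of the `ℝ≥0∞` count. [folklore] -/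
theorem collisionPairSum_one_toReal {σ : ℝ} {N : ℕ}
    (Φ : HardSphereFlow (Torus.geometry (Fin 3)) (hsDiameter σ N) (N + 1))
    {z : Config (N + 1) (Fin 3) T3} (hz : z ∈ Φ.good) (ℓ : ℝ) :
    Φ.collisionPairSum (Ioc 0 ℓ) (fun _ _ _ _ => (1 : ℝ)) z =
      (Φ.collisionPairSum (Ioc 0 ℓ) (fun _ _ _ _ => (1 : ℝ≥0∞)) z).toReal := by
  have hfin := Φ.finite_collisionTimes_inter hz (Ioc_subset_Icc_self : Ioc 0 ℓ ⊆ Icc 0 ℓ)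
  unfold HardSphereFlow.collisionPairSum
  rw [collisionPairSum_eq_finset_sum hfin, collisionPairSum_eq_finset_sum hfin,
    ENNReal.toReal_sum (fun t _ => ENNReal.sum_ne_top.2 fun p _ => ENNReal.one_ne_top)]
  refine Finset.sum_congr rfl fun t _ => ?_
  rw [ENNReal.toReal_sum (fun p _ => ENNReal.one_ne_top)]
  simp

/-- Scaling a two-sided flux comparison by a common factor. [folklore] -/
theorem two_mul_mul_le_of {a P Q R C : ℝ≥0∞} (h : 2 * P ≤ 2 * Q + C * R) :
    2 * (a * P) ≤ 2 * (a * Q) + C * (a * R) := by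
  calc 2 * (a * P) = a * (2 * P) := by ring
    _ ≤ a * (2 * Q + C * R) := mul_le_mul_right h a
    _ = 2 * (a * Q) + C * (a * R) := by ring

/-- From `2P ≤ 2Q + cR` and `2Q ≤ 2P + cR` (all finite) to `|P − Q| ≤ (c/2) R` in `ℝ`. [folklore] -/
theorem abs_toReal_sub_toReal_le {P Q R : ℝ≥0∞} {c : ℝ} (hc : 0 ≤ c) (hP : P ≠ ∞) (hQ : Q ≠ ∞) (hR : R ≠ ∞)
    (h₁ : 2 * P ≤ 2 * Q + ENNReal.ofReal c * R) (h₂ : 2 * Q ≤ 2 * P + ENNReal.ofReal c * R) :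
    |P.toReal - Q.toReal| ≤ c / 2 * R.toReal := by
  lift P to NNReal using hP
  lift Q to NNReal using hQ
  lift R to NNReal using hR
  lift c to NNReal using hc
  rw [ENNReal.ofReal_coe_nnreal] at h₁ h₂
  have h₁' : 2 * P ≤ 2 * Q + c * R := by exact_mod_cast h₁
  have h₂' : 2 * Q ≤ 2 * P + c * R := by exact_mod_cast h₂
  have h₁'' : (2 : ℝ) * P ≤ 2 * Q + c * R := by exact_mod_cast h₁'
  have h₂'' : (2 : ℝ) * Q ≤ 2 * P + c * R := by exact_mod_cast h₂'
  simp only [ENNReal.coe_toReal]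
  rw [abs_sub_le_iff]
  constructor <;> linarith

/-! ## The fixed-`N` statics under the invariant Gibbs law -/

section Statics

variable {σ θ : ℝ} (hσ : 0 < σ) (hσ2 : σ < 1 / 2) (hlam : v₁ * σ ^ 3 ≤ 1 / 2) (hθ : 0 < θ) (N : ℕ)
  (Φ : HardSphereFlow (Torus.geometry (Fin 3)) (hsDiameter σ N) (N + 1))

include hσ hσ2 hlam hθ

/-- **Counting facts**: under `G_N = localGibbsLaw σ 1 0 θ N Φ` the number `#` of ordered contact terms in the slab
`(0, ℓ]` is integrable, `E_G # = (ℓ · flux(ρ_G)).toReal`, the product `ℓ · flux(ρ_G)` is finite and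
`≤ 2 · 12 v₁ ε² (N+1) N · 2E‖v‖ · ℓ`. [folklore] -/
theorem slab_count_facts {ℓ : ℝ} (hℓ : 0 ≤ ℓ) :
    Integrable (fun z => Φ.collisionPairSum (Ioc 0 ℓ) (fun _ _ _ _ => (1 : ℝ)) z)
        (localGibbsLaw σ (fun _ => 1) (fun _ => 0) (fun _ => θ) N Φ) ∧
    ENNReal.ofReal ℓ * outgoingCollisionFlux (hsDiameter σ N) (N + 1)
        (fun w _ _ => ENNReal.ofReal (canonicalDensity (Torus.geometry (Fin 3)) (hsDiameter σ N) (N + 1)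
          (localGibbsProfile (fun _ => 1) (fun _ => 0) (fun _ => θ)) w)) ≠ ∞ ∧
    ∫ z, Φ.collisionPairSum (Ioc 0 ℓ) (fun _ _ _ _ => (1 : ℝ)) z
        ∂(localGibbsLaw σ (fun _ => 1) (fun _ => 0) (fun _ => θ) N Φ) =
      (ENNReal.ofReal ℓ * outgoingCollisionFlux (hsDiameter σ N) (N + 1)
        (fun w _ _ => ENNReal.ofReal (canonicalDensity (Torus.geometry (Fin 3)) (hsDiameter σ N) (N + 1)
          (localGibbsProfile (fun _ => 1) (fun _ => 0) (fun _ => θ)) w))).toReal ∧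
    (ENNReal.ofReal ℓ * outgoingCollisionFlux (hsDiameter σ N) (N + 1)
        (fun w _ _ => ENNReal.ofReal (canonicalDensity (Torus.geometry (Fin 3)) (hsDiameter σ N) (N + 1)
          (localGibbsProfile (fun _ => 1) (fun _ => 0) (fun _ => θ)) w))).toReal ≤
      2 * (12 * v₁ * hsDiameter σ N ^ 2 * ((N + 1 : ℝ) * N) * (2 * ∫ v, ‖v‖ ∂gaussMeasure (0 : V3) θ) * ℓ) := by
  set G := localGibbsLaw σ (fun _ => 1) (fun _ => 0) (fun _ => θ) N Φ with hG_def
  have hac : G ≪ liouville (Torus.geometry (Fin 3)) (N + 1) (hsDiameter σ N) := by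
    rw [hG_def, localGibbsLaw, particleLaw_eq]; exact withDensity_absolutelyContinuous _ _
  have hgood : ∀ᵐ z ∂G, z ∈ Φ.good := hac Φ.ae_mem_good
  have hε0 : 0 < hsDiameter σ N := hsDiameter_pos hσ N
  have hε2 : hsDiameter σ N < 1 / 2 := (hsDiameter_le hσ.le N).trans_lt hσ2
  set n : Config (N + 1) (Fin 3) T3 → ℝ≥0∞ := fun z =>
    Φ.collisionPairSum (Ioc 0 ℓ) (fun _ _ _ _ => (1 : ℝ≥0∞)) z with hn_def
  have hB : 0 ≤ 12 * v₁ * hsDiameter σ N ^ 2 * ((N + 1 : ℝ) * N) * (2 * ∫ v, ‖v‖ ∂gaussMeasure (0 : V3) θ) * ℓ := by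
    have := v₁_pos
    have : 0 ≤ ∫ v, ‖v‖ ∂gaussMeasure (0 : V3) θ := integral_nonneg fun _ => norm_nonneg _
    positivity
  have hn_eq : ∫⁻ z, n z ∂G = ENNReal.ofReal ℓ * outgoingCollisionFlux (hsDiameter σ N) (N + 1)
      (fun w _ _ => ENNReal.ofReal (canonicalDensity (Torus.geometry (Fin 3)) (hsDiameter σ N) (N + 1)
        (localGibbsProfile (fun _ => 1) (fun _ => 0) (fun _ => θ)) w)) := by
    have h := lintegral_collisionPairSum_localGibbsLaw_const hσ hσ2 1 θ 0 N Φ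
      (g := fun _ _ _ => (1 : ℝ≥0∞)) (fun _ _ => measurable_const) ℓ
    simpa only [mul_one] using h
  have hn_le : ∫⁻ z, n z ∂G ≤ ENNReal.ofReal
      (2 * (12 * v₁ * hsDiameter σ N ^ 2 * ((N + 1 : ℝ) * N) * (2 * ∫ v, ‖v‖ ∂gaussMeasure (0 : V3) θ) * ℓ)) := by
    rw [ENNReal.ofReal_mul (by norm_num : (0 : ℝ) ≤ 2), ENNReal.ofReal_ofNat]
    simpa only [mul_one] using lintegral_collisionPairSum_le_of_le hσ hσ2 hlam one_pos hθ 0 N Φ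
      (g := fun _ _ _ => (1 : ℝ≥0∞)) (C := 1) (fun _ _ _ => le_rfl) hℓ
  have hn_fin : ∫⁻ z, n z ∂G ≠ ∞ := ne_top_of_le_ne_top ENNReal.ofReal_ne_top hn_le
  have hn_meas : AEMeasurable n G :=
    (aemeasurable_collisionPairSum hε0 hε2 Φ (fun _ _ _ => (1 : ℝ≥0∞)) (fun _ _ => measurable_const) ℓ).mono_ac hac
  have hnR_ae : (fun z => Φ.collisionPairSum (Ioc 0 ℓ) (fun _ _ _ _ => (1 : ℝ)) z) =ᵐ[G] fun z => (n z).toReal := by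
    filter_upwards [hgood] with z hz
    exact collisionPairSum_one_toReal Φ hz ℓ
  refine ⟨(integrable_toReal_of_lintegral_ne_top hn_meas hn_fin).congr hnR_ae.symm, hn_eq ▸ hn_fin, ?_,
    ENNReal.toReal_le_of_le_ofReal (by positivity) (hn_eq ▸ hn_le)⟩
  rw [integral_congr_ae hnR_ae, integral_toReal hn_meas (ae_lt_top' hn_meas hn_fin), hn_eq]

/-- **Slab sums of bounded marks are `G_N`-integrable**: for continuous `χ, g, Ψ` with `|χ(t, ·)| ≤ C` on `(0, ℓ]`,
`|g| ≤ C_g`, `|Ψ| ≤ C_Ψ` and `r, ϑ > 0`, `z ↦ metroOddSum (Ioc 0 ℓ) χ g Ψ r ϑ z` is integrable under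
`localGibbsLaw σ 1 0 θ N Φ` (a.e.-measurable by S3/S3b on the conull good set, dominated by `C C_g C_Ψ #`). [folklore] -/
theorem integrable_metroOddSum {χ : ℝ × UnitAddTorus (Fin 3) → ℝ} {g : ℝ → ℝ} {Ψ : V3 × V3 × V3 → ℝ}
    {r ϑ ℓ C Cg CΨ : ℝ} (hχc : Continuous χ) (hgc : Continuous g) (hΨc : Continuous Ψ)
    (hr : 0 < r) (hϑ : 0 < ϑ) (hℓ : 0 ≤ ℓ)
    (hχ : ∀ t ∈ Ioc (0 : ℝ) ℓ, ∀ x, |χ (t, x)| ≤ C) (hg : ∀ a, |g a| ≤ Cg) (hΨ : ∀ q, |Ψ q| ≤ CΨ) :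
    Integrable (fun z => metroOddSum σ N Φ (Ioc 0 ℓ) χ g Ψ r ϑ z)
      (localGibbsLaw σ (fun _ => 1) (fun _ => 0) (fun _ => θ) N Φ) := by
  set G := localGibbsLaw σ (fun _ => 1) (fun _ => 0) (fun _ => θ) N Φ with hG_def
  have hac : G ≪ liouville (Torus.geometry (Fin 3)) (N + 1) (hsDiameter σ N) := by
    rw [hG_def, localGibbsLaw, particleLaw_eq]; exact withDensity_absolutelyContinuous _ _
  have hgood : ∀ᵐ z ∂G, z ∈ Φ.good := hac Φ.ae_mem_good
  have hσ2' : σ < 2⁻¹ := by rw [inv_eq_one_div]; exact hσ2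
  have hε0 : 0 < hsDiameter σ N := hsDiameter_pos hσ N
  have hε2 : hsDiameter σ N < 2⁻¹ := (hsDiameter_le hσ.le N).trans_lt hσ2'
  have hae : AEMeasurable (fun z => metroOddSum σ N Φ (Ioc 0 ℓ) χ g Ψ r ϑ z) G := by
    obtain ⟨hcont, hmeas⟩ := stub_metroMarkRegular hσ hσ2' N hχc hgc hΨc hr hϑ
    obtain ⟨hIoc, -⟩ := stub_collisionPairSumMeasurable hε0 hε2 Φ
      (fun t z' i j => metroOddMark σ N χ g Ψ r ϑ t z' i j) hcont hmeas 0 ℓ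
    refine hIoc.aemeasurable.congr ?_
    filter_upwards [hgood] with z hz
    rw [indicator_of_mem hz]
    exact (metroOddSum_eq_collisionPairSum_of_mem_good _ _ hz).symm
  obtain ⟨hnR, -⟩ := slab_count_facts hσ hσ2 hlam hθ N Φ hℓ
  refine (hnR.const_mul (C * Cg * CΨ)).mono' hae.aestronglyMeasurable ?_
  filter_upwards [hgood] with z hz
  rw [Real.norm_eq_abs]
  exact abs_metroOddSum_le Φ hχ hg hΨ hz

/-- **Frozen-weight facts**: for a time-independent weight `χ₀` the slab sum is integrable and its mean is
`(ℓ · flux(ρ_G m₀⁺)).toReal − (ℓ · flux(ρ_G m₀⁻)).toReal`, `m₀` the (time-independent) mark, both products being finite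
(signed Campbell under `G_N` + counting). [folklore] -/
theorem slab_frozen_facts {χ₀ : UnitAddTorus (Fin 3) → ℝ} {g : ℝ → ℝ} {Ψ : V3 × V3 × V3 → ℝ}
    {r ϑ ℓ Cχ Cg CΨ : ℝ} (hχ₀c : Continuous χ₀) (hgc : Continuous g) (hΨc : Continuous Ψ)
    (hr : 0 < r) (hϑ : 0 < ϑ) (hℓ : 0 ≤ ℓ)
    (hχ₀ : ∀ x, |χ₀ x| ≤ Cχ) (hg : ∀ a, |g a| ≤ Cg) (hΨ : ∀ q, |Ψ q| ≤ CΨ) :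
    Integrable (fun z => metroOddSum σ N Φ (Ioc 0 ℓ) (fun p => χ₀ p.2) g Ψ r ϑ z)
        (localGibbsLaw σ (fun _ => 1) (fun _ => 0) (fun _ => θ) N Φ) ∧
    ENNReal.ofReal ℓ * outgoingCollisionFlux (hsDiameter σ N) (N + 1)
        (fun w i j => ENNReal.ofReal (canonicalDensity (Torus.geometry (Fin 3)) (hsDiameter σ N) (N + 1)
          (localGibbsProfile (fun _ => 1) (fun _ => 0) (fun _ => θ)) w) *
          ENNReal.ofReal (metroOddMark σ N (fun p => χ₀ p.2) g Ψ r ϑ 0 w i j)) ≠ ∞ ∧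
    ENNReal.ofReal ℓ * outgoingCollisionFlux (hsDiameter σ N) (N + 1)
        (fun w i j => ENNReal.ofReal (canonicalDensity (Torus.geometry (Fin 3)) (hsDiameter σ N) (N + 1)
          (localGibbsProfile (fun _ => 1) (fun _ => 0) (fun _ => θ)) w) *
          ENNReal.ofReal (-metroOddMark σ N (fun p => χ₀ p.2) g Ψ r ϑ 0 w i j)) ≠ ∞ ∧
    ∫ z, metroOddSum σ N Φ (Ioc 0 ℓ) (fun p => χ₀ p.2) g Ψ r ϑ z
        ∂(localGibbsLaw σ (fun _ => 1) (fun _ => 0) (fun _ => θ) N Φ) =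
      (ENNReal.ofReal ℓ * outgoingCollisionFlux (hsDiameter σ N) (N + 1)
        (fun w i j => ENNReal.ofReal (canonicalDensity (Torus.geometry (Fin 3)) (hsDiameter σ N) (N + 1)
          (localGibbsProfile (fun _ => 1) (fun _ => 0) (fun _ => θ)) w) *
          ENNReal.ofReal (metroOddMark σ N (fun p => χ₀ p.2) g Ψ r ϑ 0 w i j))).toReal -
      (ENNReal.ofReal ℓ * outgoingCollisionFlux (hsDiameter σ N) (N + 1)
        (fun w i j => ENNReal.ofReal (canonicalDensity (Torus.geometry (Fin 3)) (hsDiameter σ N) (N + 1)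
          (localGibbsProfile (fun _ => 1) (fun _ => 0) (fun _ => θ)) w) *
          ENNReal.ofReal (-metroOddMark σ N (fun p => χ₀ p.2) g Ψ r ϑ 0 w i j))).toReal := by
  set G := localGibbsLaw σ (fun _ => 1) (fun _ => 0) (fun _ => θ) N Φ with hG_def
  have hac : G ≪ liouville (Torus.geometry (Fin 3)) (N + 1) (hsDiameter σ N) := by
    rw [hG_def, localGibbsLaw, particleLaw_eq]; exact withDensity_absolutelyContinuous _ _
  have hgood : ∀ᵐ z ∂G, z ∈ Φ.good := hac Φ.ae_mem_good
  have hχc : Continuous fun p : ℝ × UnitAddTorus (Fin 3) => χ₀ p.2 := hχ₀c.comp continuous_snd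
  have hχb : ∀ p : ℝ × UnitAddTorus (Fin 3), |χ₀ p.2| ≤ Cχ := fun p => hχ₀ p.2
  set m₀ : Config (N + 1) (Fin 3) T3 → Fin (N + 1) → Fin (N + 1) → ℝ := fun w i j =>
    metroOddMark σ N (fun p => χ₀ p.2) g Ψ r ϑ 0 w i j with hm₀_def
  have hmeas : ∀ i j, Measurable fun w => m₀ w i j := fun i j =>
    measurable_metroOddMark σ N hχc hgc hΨc r ϑ 0 i j
  have hmb : ∀ w i j, |m₀ w i j| ≤ Cχ * Cg * CΨ := fun w i j => abs_metroOddMark_le hχb hg hΨ 0 w i j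
  have hbound : ∀ (f : ℝ → ℝ), (∀ x, f x ≤ |x|) →
      ∫⁻ z, Φ.collisionPairSum (Ioc 0 ℓ) (fun _ w i j => ENNReal.ofReal (f (m₀ w i j))) z ∂G ≠ ∞ := by
    intro f hf
    refine ne_top_of_le_ne_top ?_ (lintegral_collisionPairSum_le_of_le hσ hσ2 hlam one_pos hθ 0 N Φ
      (g := fun w i j => ENNReal.ofReal (f (m₀ w i j))) (C := ENNReal.ofReal (Cχ * Cg * CΨ))
      (fun w i j => ENNReal.ofReal_le_ofReal ((hf _).trans (hmb w i j))) hℓ)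
    exact ENNReal.mul_ne_top (ENNReal.mul_ne_top (by norm_num) ENNReal.ofReal_ne_top) ENNReal.ofReal_ne_top
  have hCampbell := integral_collisionPairSum_localGibbsLaw_const hσ hσ2 1 θ 0 N Φ hmeas ℓ
    (hbound (fun x => |x|) (fun x => le_rfl))
  refine ⟨integrable_metroOddSum hσ hσ2 hlam hθ N Φ hχc hgc hΨc hr hϑ hℓ (fun t _ x => hχb (t, x)) hg hΨ, ?_, ?_, ?_⟩
  · have h := hbound (fun x => x) (fun x => le_abs_self x)
    rwa [lintegral_collisionPairSum_localGibbsLaw_const hσ hσ2 1 θ 0 N Φ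
      (g := fun w i j => ENNReal.ofReal (m₀ w i j)) (fun i j => (hmeas i j).ennreal_ofReal) ℓ] at h
  · have h := hbound (fun x => -x) (fun x => neg_le_abs x)
    rwa [lintegral_collisionPairSum_localGibbsLaw_const hσ hσ2 1 θ 0 N Φ
      (g := fun w i j => ENNReal.ofReal (-m₀ w i j)) (fun i j => (hmeas i j).neg.ennreal_ofReal) ℓ] at h
  · rw [← hCampbell]
    refine integral_congr_ae ?_
    filter_upwards [hgood] with z hz
    rw [metroOddSum_eq_collisionPairSum_of_mem_good Φ _ hz, metroOddMark_frozen]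

end Statics

/-- **The fixed-`N` core of G2** (registered helper stub of `stub_slabCentring_of`).  Under `G_N = localGibbsLaw σ 1 0 θ N Φ`,
for a slab `(0, ℓ]`, a weight `χ₁` with `|χ₁(t, ·)| ≤ C_χ` on the slab and a frozen weight `χ₀`, `|χ₀| ≤ C_χ`, with
`|χ₁(t, ·) − χ₀| ≤ e` on the slab, bounded continuous `g, Ψ`: IF the Gibbs contact fluxes of the frozen mark `m₀` obey the
parity comparison `2 flux(ρ m₀^±) ≤ 2 flux(ρ m₀^∓) + C_gC_Ψ e flux(ρ) + 2C_χC_gC_Ψ flux(ρ δ)` (shape of G1 `stub_fluxOddBound`)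
and the defect bound `flux(ρ δ) ≤ y′ flux(ρ)` (shape of P4 `stub_maxwellDefectFlux`), THEN
`|E_G X₁| ≤ (½(C_gC_Ψ e + 2C_χC_gC_Ψ y′) + e C_gC_Ψ) · 2·12 v₁ ε²(N+1)N · 2E‖v‖ · ℓ`
(`|E X₁| ≤ |E X₀| + E|X₁ − X₀|`, signed Campbell for `X₀`, time-freezing for the difference, counting). [folklore] -/
theorem slab_mean_core :
    ∀ {σ θ : ℝ} (_hσ : 0 < σ) (_hσ2 : σ < 1 / 2) (_hlam : v₁ * σ ^ 3 ≤ 1 / 2) (_hθ : 0 < θ) (N : ℕ)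
    (Φ : HardSphereFlow (Torus.geometry (Fin 3)) (hsDiameter σ N) (N + 1))
    {χ₁ : ℝ × UnitAddTorus (Fin 3) → ℝ} {χ₀ : UnitAddTorus (Fin 3) → ℝ} {g : ℝ → ℝ} {Ψ : V3 × V3 × V3 → ℝ}
    {r ϑ ℓ e y' Cχ Cg CΨ : ℝ}
    (_hχ₁c : Continuous χ₁) (_hχ₀c : Continuous χ₀) (_hgc : Continuous g) (_hΨc : Continuous Ψ)
    (_hr : 0 < r) (_hϑ : 0 < ϑ) (_hℓ : 0 ≤ ℓ) (_he : 0 ≤ e) (_hy' : 0 ≤ y') (_hCχ : 0 ≤ Cχ)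
    (_hχ₁ : ∀ t ∈ Set.Ioc (0 : ℝ) ℓ, ∀ x, |χ₁ (t, x)| ≤ Cχ) (_hχ₀ : ∀ x, |χ₀ x| ≤ Cχ)
    (_hg : ∀ a, |g a| ≤ Cg) (_hΨ : ∀ q, |Ψ q| ≤ CΨ)
    (_hω : ∀ t ∈ Set.Ioc (0 : ℝ) ℓ, ∀ x, |χ₁ (t, x) - χ₀ x| ≤ e)
    (_hG1 : 2 * outgoingCollisionFlux (hsDiameter σ N) (N + 1)
          (fun w i j => ENNReal.ofReal (canonicalDensity (Torus.geometry (Fin 3)) (hsDiameter σ N) (N + 1)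
              (localGibbsProfile (fun _ => 1) (fun _ => 0) (fun _ => θ)) w) *
            ENNReal.ofReal (metroOddMark σ N (fun p => χ₀ p.2) g Ψ r ϑ 0 w i j)) ≤
        2 * outgoingCollisionFlux (hsDiameter σ N) (N + 1)
          (fun w i j => ENNReal.ofReal (canonicalDensity (Torus.geometry (Fin 3)) (hsDiameter σ N) (N + 1)
              (localGibbsProfile (fun _ => 1) (fun _ => 0) (fun _ => θ)) w) *
            ENNReal.ofReal (-metroOddMark σ N (fun p => χ₀ p.2) g Ψ r ϑ 0 w i j)) +
        (ENNReal.ofReal (Cg * CΨ * e) * outgoingCollisionFlux (hsDiameter σ N) (N + 1)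
          (fun w _ _ => ENNReal.ofReal (canonicalDensity (Torus.geometry (Fin 3)) (hsDiameter σ N) (N + 1)
              (localGibbsProfile (fun _ => 1) (fun _ => 0) (fun _ => θ)) w)) +
         ENNReal.ofReal (2 * Cχ * Cg * CΨ) * outgoingCollisionFlux (hsDiameter σ N) (N + 1)
          (fun w i j => ENNReal.ofReal (canonicalDensity (Torus.geometry (Fin 3)) (hsDiameter σ N) (N + 1)
              (localGibbsProfile (fun _ => 1) (fun _ => 0) (fun _ => θ)) w) *
            ENNReal.ofReal (1 - metroOddMark σ N (fun _ => 1) (fun _ => 1) (fun _ => 1) r ϑ 0 w i j))) ∧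
      2 * outgoingCollisionFlux (hsDiameter σ N) (N + 1)
          (fun w i j => ENNReal.ofReal (canonicalDensity (Torus.geometry (Fin 3)) (hsDiameter σ N) (N + 1)
              (localGibbsProfile (fun _ => 1) (fun _ => 0) (fun _ => θ)) w) *
            ENNReal.ofReal (-metroOddMark σ N (fun p => χ₀ p.2) g Ψ r ϑ 0 w i j)) ≤
        2 * outgoingCollisionFlux (hsDiameter σ N) (N + 1)
          (fun w i j => ENNReal.ofReal (canonicalDensity (Torus.geometry (Fin 3)) (hsDiameter σ N) (N + 1)
              (localGibbsProfile (fun _ => 1) (fun _ => 0) (fun _ => θ)) w) *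
            ENNReal.ofReal (metroOddMark σ N (fun p => χ₀ p.2) g Ψ r ϑ 0 w i j)) +
        (ENNReal.ofReal (Cg * CΨ * e) * outgoingCollisionFlux (hsDiameter σ N) (N + 1)
          (fun w _ _ => ENNReal.ofReal (canonicalDensity (Torus.geometry (Fin 3)) (hsDiameter σ N) (N + 1)
              (localGibbsProfile (fun _ => 1) (fun _ => 0) (fun _ => θ)) w)) +
         ENNReal.ofReal (2 * Cχ * Cg * CΨ) * outgoingCollisionFlux (hsDiameter σ N) (N + 1)
          (fun w i j => ENNReal.ofReal (canonicalDensity (Torus.geometry (Fin 3)) (hsDiameter σ N) (N + 1)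
              (localGibbsProfile (fun _ => 1) (fun _ => 0) (fun _ => θ)) w) *
            ENNReal.ofReal (1 - metroOddMark σ N (fun _ => 1) (fun _ => 1) (fun _ => 1) r ϑ 0 w i j))))
    (_hP4 : outgoingCollisionFlux (hsDiameter σ N) (N + 1)
          (fun w i j => ENNReal.ofReal (canonicalDensity (Torus.geometry (Fin 3)) (hsDiameter σ N) (N + 1)
              (localGibbsProfile (fun _ => 1) (fun _ => 0) (fun _ => θ)) w) *
            ENNReal.ofReal (1 - metroOddMark σ N (fun _ => 1) (fun _ => 1) (fun _ => 1) r ϑ 0 w i j)) ≤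
        ENNReal.ofReal y' * outgoingCollisionFlux (hsDiameter σ N) (N + 1)
          (fun w _ _ => ENNReal.ofReal (canonicalDensity (Torus.geometry (Fin 3)) (hsDiameter σ N) (N + 1)
              (localGibbsProfile (fun _ => 1) (fun _ => 0) (fun _ => θ)) w))),
    |∫ z, metroOddSum σ N Φ (Set.Ioc 0 ℓ) χ₁ g Ψ r ϑ z ∂(localGibbsLaw σ (fun _ => 1) (fun _ => 0) (fun _ => θ) N Φ)| ≤
      ((Cg * CΨ * e + 2 * Cχ * Cg * CΨ * y') / 2 + e * Cg * CΨ) *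
        (2 * (12 * v₁ * hsDiameter σ N ^ 2 * ((N + 1 : ℝ) * N) * (2 * ∫ v, ‖v‖ ∂gaussMeasure (0 : V3) θ) * ℓ)) := by
  intro σ θ hσ hσ2 hlam hθ N Φ χ₁ χ₀ g Ψ r ϑ ℓ e y' Cχ Cg CΨ hχ₁c hχ₀c hgc hΨc hr hϑ hℓ he hy' hCχ hχ₁ hχ₀ hg hΨ hω
    hG1 hP4
  have hCg : 0 ≤ Cg := (abs_nonneg _).trans (hg 0)
  have hCΨ : 0 ≤ CΨ := (abs_nonneg _).trans (hΨ 0)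
  -- notation
  set G := localGibbsLaw σ (fun _ => 1) (fun _ => 0) (fun _ => θ) N Φ with hG_def
  have hgood : ∀ᵐ z ∂G, z ∈ Φ.good := by
    have hac : G ≪ liouville (Torus.geometry (Fin 3)) (N + 1) (hsDiameter σ N) := by
      rw [hG_def, localGibbsLaw, particleLaw_eq]; exact withDensity_absolutelyContinuous _ _
    exact hac Φ.ae_mem_good
  set ρ : Config (N + 1) (Fin 3) T3 → ℝ := fun w => canonicalDensity (Torus.geometry (Fin 3)) (hsDiameter σ N) (N + 1)
    (localGibbsProfile (fun _ => 1) (fun _ => 0) (fun _ => θ)) w with hρ_def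
  set Fp : ℝ≥0∞ := outgoingCollisionFlux (hsDiameter σ N) (N + 1)
    (fun w i j => ENNReal.ofReal (ρ w) * ENNReal.ofReal (metroOddMark σ N (fun p => χ₀ p.2) g Ψ r ϑ 0 w i j))
    with hFp_def
  set Fm : ℝ≥0∞ := outgoingCollisionFlux (hsDiameter σ N) (N + 1)
    (fun w i j => ENNReal.ofReal (ρ w) * ENNReal.ofReal (-metroOddMark σ N (fun p => χ₀ p.2) g Ψ r ϑ 0 w i j))
    with hFm_def
  set F1 : ℝ≥0∞ := outgoingCollisionFlux (hsDiameter σ N) (N + 1) (fun w _ _ => ENNReal.ofReal (ρ w)) with hF1_def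
  set Fδ : ℝ≥0∞ := outgoingCollisionFlux (hsDiameter σ N) (N + 1)
    (fun w i j => ENNReal.ofReal (ρ w) *
      ENNReal.ofReal (1 - metroOddMark σ N (fun _ => 1) (fun _ => 1) (fun _ => 1) r ϑ 0 w i j)) with hFδ_def
  set B : ℝ := 2 * (12 * v₁ * hsDiameter σ N ^ 2 * ((N + 1 : ℝ) * N) * (2 * ∫ v, ‖v‖ ∂gaussMeasure (0 : V3) θ) * ℓ)
    with hB_def
  set X₁ : Config (N + 1) (Fin 3) T3 → ℝ := fun z => metroOddSum σ N Φ (Ioc 0 ℓ) χ₁ g Ψ r ϑ z with hX₁_def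
  set X₀ : Config (N + 1) (Fin 3) T3 → ℝ := fun z => metroOddSum σ N Φ (Ioc 0 ℓ) (fun p => χ₀ p.2) g Ψ r ϑ z
    with hX₀_def
  set nR : Config (N + 1) (Fin 3) T3 → ℝ := fun z =>
    Φ.collisionPairSum (Ioc 0 ℓ) (fun _ _ _ _ => (1 : ℝ)) z with hnR_def
  -- the three inputs
  obtain ⟨hnR_int, hA1fin, hnR_val, hA1le⟩ := slab_count_facts hσ hσ2 hlam hθ N Φ hℓ
  obtain ⟨hX₀i, hApfin, hAmfin, hX₀val⟩ :=
    slab_frozen_facts hσ hσ2 hlam hθ N Φ hχ₀c hgc hΨc hr hϑ hℓ hχ₀ hg hΨ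
  have hX₁i : Integrable X₁ G := integrable_metroOddSum hσ hσ2 hlam hθ N Φ hχ₁c hgc hΨc hr hϑ hℓ hχ₁ hg hΨ
  have hB0 : 0 ≤ B := le_trans ENNReal.toReal_nonneg hA1le
  -- (d) the flux comparison, `c = C_g C_Ψ e + 2 C_χ C_g C_Ψ y'`
  have hc0 : 0 ≤ Cg * CΨ * e + 2 * Cχ * Cg * CΨ * y' := by positivity
  have hR : ENNReal.ofReal (Cg * CΨ * e) * F1 + ENNReal.ofReal (2 * Cχ * Cg * CΨ) * Fδ ≤
      ENNReal.ofReal (Cg * CΨ * e + 2 * Cχ * Cg * CΨ * y') * F1 := by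
    calc ENNReal.ofReal (Cg * CΨ * e) * F1 + ENNReal.ofReal (2 * Cχ * Cg * CΨ) * Fδ
        ≤ ENNReal.ofReal (Cg * CΨ * e) * F1 + ENNReal.ofReal (2 * Cχ * Cg * CΨ) * (ENNReal.ofReal y' * F1) := by
          gcongr
      _ = ENNReal.ofReal (Cg * CΨ * e + 2 * Cχ * Cg * CΨ * y') * F1 := by
          rw [← mul_assoc, ← ENNReal.ofReal_mul (by positivity), ← add_mul,
            ← ENNReal.ofReal_add (by positivity) (by positivity)]
  have hAbs : |(ENNReal.ofReal ℓ * Fp).toReal - (ENNReal.ofReal ℓ * Fm).toReal| ≤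
      (Cg * CΨ * e + 2 * Cχ * Cg * CΨ * y') / 2 * (ENNReal.ofReal ℓ * F1).toReal :=
    abs_toReal_sub_toReal_le hc0 hApfin hAmfin hA1fin
      (two_mul_mul_le_of (hG1.1.trans (add_le_add_right hR _)))
      (two_mul_mul_le_of (hG1.2.trans (add_le_add_right hR _)))
  -- (a) time-freezing
  have hdiff : ∀ᵐ z ∂G, |X₁ z - X₀ z| ≤ e * Cg * CΨ * nR z := by
    filter_upwards [hgood] with z hz
    exact abs_metroOddSum_sub_le Φ (χ₂ := fun p => χ₀ p.2) hω hg hΨ hz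
  have hdiff_int : |∫ z, (X₁ z - X₀ z) ∂G| ≤ e * Cg * CΨ * B := by
    calc |∫ z, (X₁ z - X₀ z) ∂G| ≤ ∫ z, |X₁ z - X₀ z| ∂G := abs_integral_le_integral_abs
      _ ≤ ∫ z, e * Cg * CΨ * nR z ∂G := integral_mono_ae (hX₁i.sub hX₀i).abs (hnR_int.const_mul _) hdiff
      _ = e * Cg * CΨ * (ENNReal.ofReal ℓ * F1).toReal := by rw [integral_const_mul, hnR_val]
      _ ≤ e * Cg * CΨ * B := mul_le_mul_of_nonneg_left hA1le (by positivity)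
  -- assembly
  have hsplit : ∫ z, X₁ z ∂G = ∫ z, X₀ z ∂G + ∫ z, (X₁ z - X₀ z) ∂G := by
    rw [integral_sub hX₁i hX₀i]; ring
  calc |∫ z, X₁ z ∂G|
      = |((ENNReal.ofReal ℓ * Fp).toReal - (ENNReal.ofReal ℓ * Fm).toReal) + ∫ z, (X₁ z - X₀ z) ∂G| := by
        rw [hsplit, hX₀val]
    _ ≤ |(ENNReal.ofReal ℓ * Fp).toReal - (ENNReal.ofReal ℓ * Fm).toReal| + |∫ z, (X₁ z - X₀ z) ∂G| :=
        abs_add_le _ _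
    _ ≤ (Cg * CΨ * e + 2 * Cχ * Cg * CΨ * y') / 2 * (ENNReal.ofReal ℓ * F1).toReal + e * Cg * CΨ * B :=
        add_le_add hAbs hdiff_int
    _ ≤ (Cg * CΨ * e + 2 * Cχ * Cg * CΨ * y') / 2 * B + e * Cg * CΨ * B := by gcongr
    _ = ((Cg * CΨ * e + 2 * Cχ * Cg * CΨ * y') / 2 + e * Cg * CΨ) * B := by ring

end Summit.AtomisticToContinuum.HydrodynamicLimit.Theorems.OddContactSymmetryKineticSlab

end
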